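import Literature.Analysis.FluidPDE.CKNMorreyKukavica
import Literature.Analysis.FluidPDE.CKNMorreyPressureEstimates
import Literature.Analysis.FluidPDE.CKNInterpolationEstimate
import Literature.Analysis.FluidPDE.CKNPressureLocalization
import Literature.Analysis.FluidPDE.CKNPressureLocalizationProofs
import HarnessLib

/-!
# Lemarié-Rieusset 2016, Lemma 13.4 (Morrey estimates) and the local integrability of the pressure under `(ℋ_CKN)` — discharged

Analysis/FluidPDE glue file **discharging the named facts
`Literature.Analysis.FluidPDE.LemarieRieusset2016.lemma13_4`** (`CKNMorreyLemmas.lean`; P. G.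
Lemarié-Rieusset, *The Navier–Stokes Problem in the 21st Century*, CRC Press 2016, Lemma 13.4,
p. 470, after Kukavica: the Morrey estimates for the velocity and the pressure, with the gradient
bound of Step 3, p. 474) **and `Literature.Analysis.FluidPDE.LemarieRieusset2016.pressure_localIntegrability`**
(`CKNMorreyLemmas.lean`; (13.19)–(13.21), p. 461, as used in §13.9, p. 467: local space–time
integrability of the pressure under `(ℋ_CKN)`). The accepted tree reductions are
`LemarieRieusset2016.lemma13_4_of` (`CKNMorreyKukavica.lean`, from Lemma 13.3 and the interpolation
estimate) and `LemarieRieusset2016.pressure_localIntegrability_of_splitting`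
(`CKNPressureLocalization.lean`, from the pressure splitting (13.19)–(13.21)); the inputs are
discharged: `LemarieRieusset2016.lemma13_3_holds` (`CKNMorreyPressureEstimates.lean`),
`interpolationEstimate_holds` (`CKNInterpolationEstimate.lean`) and
`LemarieRieusset2016.pressure_splitting_holds` (`CKNPressureLocalizationProofs.lean`).

Theorem-only glue module: no definitions, no named facts, no `sorry`; each theorem is a
composition of an accepted tree reduction with accepted discharges (pure proof of an
unchanged statement).

## References

* P. G. Lemarié-Rieusset, *The Navier–Stokes Problem in the 21st Century*, CRC Press (2016),
  Lemma 13.3, Lemma 13.4 (p. 470), Step 3 (p. 474), (13.19)–(13.21) (p. 461), §13.9 (p. 467).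
  [LemarieRieusset2016]
* I. Kukavica, *On partial regularity for the Navier–Stokes equations*, Discrete Contin. Dyn.
  Syst. 21 (2008), 717–728.
-/

noncomputable section

namespace Literature.Analysis.FluidPDE.LemarieRieusset2016

/-- **Lemarié-Rieusset 2016, Lemma 13.4 (Morrey estimates for the velocity and the pressure),
proved** (the named statement `LemarieRieusset2016.lemma13_4`), by `lemma13_4_of`,
`lemma13_3_holds` and `interpolationEstimate_holds`. [cite: LemarieRieusset2016, Lemma 13.4 p. 470 and Step 3 p. 474] -/
theorem lemma13_4_holds : lemma13_4 :=
  lemma13_4_of lemma13_3_holds interpolationEstimate_holds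

/-- **Local space–time integrability of the pressure under `(ℋ_CKN)`, proved** (the named
statement `LemarieRieusset2016.pressure_localIntegrability`), by
`pressure_localIntegrability_of_splitting` and `pressure_splitting_holds`. [cite: LemarieRieusset2016, (13.19)–(13.21) p. 461 and §13.9 p. 467] -/
theorem pressure_localIntegrability_holds : pressure_localIntegrability :=
  pressure_localIntegrability_of_splitting pressure_splitting_holds

end Literature.Analysis.FluidPDE.LemarieRieusset2016
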